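import Summits.ValiantsHypothesis.ValiantsHypothesis.Theorems.NewtonUnitEquationsTwoProductsRankOneSchemaLawWeights
import HarnessLib

/-!
# Route NewtonUnitEquations — crux `TwoProducts` (stmt-ValiantsHypothesis-5906), line `relation_ladder`, rung R9 (the RANK-ONE
# SCHEMA law: ONE datum `(ρ⁺, ρ⁻)` of ANY shape) by the TRANSPORTATION LIFT — part 7/8 — the per-slice count, the count for a non-degenerate relation, degenerate data are permutation type, the balance of a realised datum (T8 end, T9 start)

THE RANK-ONE SCHEMA LAW (R9): if ALL additive coincidences of the letter family of `(u, v)` are multiples of ONE datum `(ρ⁺, ρ⁻)` —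
ANY datum `ρ⁺, ρ⁻ : Expo →₀ ℕ`, no side condition — then GLOBALLY `#visible ≤ 2^{c m}(#T + 2)^c` (`c = 1416`).  This is the rank-one SCHEMA
quantified over the datum asked for by the Negative lane (val-neg-1 g4, evidence #48 on stmt-5906, item (a)); it SUBSUMES the rungs R3♯
(`permTypeLaw_proof`), R6, R6b, R6c, R7a, R7b, R7c, R8 (each of their hypotheses exhibits a datum).  Engine = the TRANSPORTATION LIFT of
val-idea-8 g3's memo `Cruxes/TwoProducts/Lines/relation_ladder_R7_engine.md` §1 / `…R8_engine.md` §5 made uniform: for the disjoint balanced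
relation `Σ_{i ∈ P} p_i • α_i = Σ_{j ∈ N} q_j • β_j` the atoms are `Z_{ij}`, `(i, j) ∈ P × N` (upstairs index type `σ ⊕ σ × σ`: free letters on
the left, atoms on the right), `Y_{α_i} ↦ ∏_j Z_{ij}^{q_j}`, `Y_{β_j} ↦ ∏_i Z_{ij}^{p_i}`; the planar push-forward is the PRODUCT PLAN
`E'(Z_{ij})_c = (α_i)_c (β_j)_c T'_{1-c}` over the `D = T'_0 T'_1`-dilated plane (`T_c = Σ_i p_i (α_i)_c`, `T' = max(T, 1)`), the upstairs
weights are the PRODUCT PLAN `θ_{ij} = r_i r_j / R` of the letter weights (pointwise positive, NOT a pull-back; balanced because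
`Σ p_i r_i = Σ q_j r_j`); the fibre over an atom monomial is parametrised by `κ = #α_{a₀}` with a CONSISTENCY guard over all `|P|·|N|` atom
equations; SLICING by the atom exponents (≤ `2^{3m}` slices through the simplex `R8.card_W_le`); the coefficient theorem
`Pfac · C(R + B_κ − 1, B_κ) · κ_κ` and the shift rank `2m(ΣA + 1)² + 1` are shape-independent (the free letters enter only through the binomial);
`ShiftRank.pencilCount` BY NAME.  Reductions: common part of the datum (`DatumExcess.rankOne_reduce`), large / absent coefficients
(`R7a.permType_of_rankOne_largeCoeff/absent`), wide sides (`permType_of_rankOne_wideSide`), and a non-permutation coincidence balances the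
datum and makes both sides non-empty (`sides_of_shift`, over val-neg-1 g4's `OneSidedMembership.weight_*` / `DatumExcess.*`).

AUTHORSHIP / LANE NOTE (val-lit-p3 g16, prover seat, KEEP lineage, helper mode `--supports stmt-ValiantsHypothesis-5906 --as helper`;
CLAIM #1 on the val-lit bus 14:45Z 2026-08-28, ★ 15:03Z; no val-idea-8 seat alive at the time — the typed target is staged for the line
owner as `HOME/lmr/staged/p3g16-R9/sketch_R9.lean`, and the closing theorem is stated by its LITERAL BODY so that a later skeleton can wire
`stub := R9.rankOneSchemaLaw_proof` by name).  Mathematics and Lean text of this module: this seat, generalising its predecessor's R8 port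
(`…RankOneOneSidedLaw*`, val-lit-p3 g15) decl by decl.  Reused BY NAME: `R6b.HSD` (+ closure lemmas), `R7b.dilE`/`piT_dilE`/`piE_dilE`,
`R7a.choose_bridge`, `R7a.permType_of_rankOne_largeCoeff/absent`, `toolBound_mono`, `tab`, `sgn`, `R6b.sum_sgn`, `rW`/`R6b.rW_pos`, `lwt_piT`,
`PlanarCell.eq_of_nsmul_eq`/`wt_sum`, `FormalLogLinearisation.wt_nsmul`, `R8.W`/`R8.card_W_le`, `ShiftRank.pencilCount`,
`BinExpSum.pencilCount_arith`, val-neg-1 g4's `DatumExcess.*`, `RankOneCoverage.eq_of_tsub_eq_zero`, `OneSidedMembership.*`.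
Namespace `…PermutationType.R9`.  Nothing here closes the line's residual (`ResidualLawV20`), the crux `TwoProducts` (5906) or `VP ≠ VNP`;
no summit statement is proved.

Honest scope: coincidence modules of RANK ≥ 2 (val-neg-1 g4's p635223 `RankTwoEscapes`) are NOT covered; after R9 the residual of the line is
«no lattice-small permutation-type contraction (R5), no cheap class cover (R1_r), coincidence rank ≥ 2».  Nothing here moves VP ≠ VNP;
`TwoProducts` (5906) / `PlanarCellBound` stay OPEN. [folklore]

Cut table (scratch `HOME/lmr/staged/p3g16-R9/R9-Scratch.lean`, 2 249 lines, rc 0 / 0 warnings / 0 sorries, axioms standard): part 1 `…Lift` =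
T2 (`GIdx`, `P`/`N`/`rel`/`rest`, `frM` and its coordinates, `Idle`, the table sums `sum_frM_inl/inr`); part 2 `…Fibres` = T3 (`xhat`, `Lrel`,
`Lof`, `Adm`, `sA`, `KR`, `eq_Lof_of_piT`, `piT_Lof`, degrees, `Bk`, `Pfac`, `kap`, `multinomial_Lof_eq`, `coeff_phiT_frM`); part 3 `…Slice` =
T4 slice functions, THE COEFFICIENT THEOREM `coeff_free_logTrunc`, T5 finite shift rank `Fsl_shift`; part 4 `…SliceExc` = the exceptional point,
`mem_support_free_logTrunc_iff`, `Fsl_zero_zero`, `xOf`, `Fsl_congr`; part 5 `…Planar` = T7 `RelDataG`, `D`, `cell`, `enumP`, `piE_enumP_frM`,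
`phi_GT`, `injOn_of_rankOne`, `lifted_of_visible`; part 6 `…Weights` = product-plan weights `θW`, `lwt_θW_frM`, `lwt_splitG`, T8
`sliceMin_of_visible`; part 7 `…Count` = `sliceCount`, `RelDataG.count`, `permType_of_rankOne_wideSide`, `sides_of_shift`, `sum_enum_smul_eq`,
`mapDomain_enum_table`; part 8 `…Law` = arithmetic (`c = 1416`), `rankOneSchemaLaw_proof`.
-/

noncomputable section

-- Sub = Summit single-conjunct layout: the duplicated namespace component is mandated by the tree.
set_option linter.dupNamespace false
set_option linter.unusedSimpArgs false
set_option linter.unusedSectionVars false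
set_option linter.unusedVariables false

namespace Summit.ValiantsHypothesis.ValiantsHypothesis.Theorems.NewtonUnitEquations.TwoProducts.PermutationType
namespace R9
open scoped BigOperators
open MvPolynomial

variable {σ : Type*} [Fintype σ] [DecidableEq σ]

variable (Itr : GIdx σ)

section GenCount
open Summit.ValiantsHypothesis.ValiantsHypothesis.Theorems.NewtonUnitEquations.TwoProducts.FormalLogLinearisation
open Summit.ValiantsHypothesis.ValiantsHypothesis.Theorems.NewtonUnitEquations.TwoProducts.PlanarCell

variable {m : ℕ} {u v : Fin m → MvPolynomial (Fin 2) ℂ} (Dtr : RelDataG u v)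

/-- **The per-slice count** from finite shift rank (`ShiftRank.pencilCount`, BY NAME). [folklore] -/
theorem RelDataG.sliceCount (b : Fin (sE u v) × Fin (sE u v) → ℕ) (hb : sA Dtr.idx b ≤ 2 * (m * m * m))
    (U V : Fin (sE u v) → ℝ) (Sb : Finset (Fin (sE u v) → ℕ))
    (hhyp : ∀ μ ∈ Sb, Fsl Dtr.idx (cU u v) (cV u v) b μ ≠ 0 ∧ ∃ t : ℝ, ∀ ν : Fin (sE u v) → ℕ, ν ≠ μ →
      Fsl Dtr.idx (cU u v) (cV u v) b ν ≠ 0 → ∑ i, (U i + t * V i) * (μ i : ℝ) < ∑ i, (U i + t * V i) * (ν i : ℝ)) :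
    Sb.card ≤ sliceBdG m (sE u v) := by
  obtain ⟨col, ch, hF⟩ := Fsl_shift Dtr.idx (cU u v) (cV u v) b
  have h1 := ShiftRank.pencilCount hF U V Sb hhyp
  rw [card_SIdxG] at h1
  have h2 := BinExpSum.pencilCount_arith (sE u v) (2 * m * (sA Dtr.idx b + 1) ^ 2 + 1)
  have h3 : 2 * m * (sA Dtr.idx b + 1) ^ 2 + 1 ≤ NmG m :=
    Nat.add_le_add_right (Nat.mul_le_mul_left _ (Nat.pow_le_pow_left (by omega) 2)) 1
  exact h1.trans (h2.trans (toolBound_mono (sE u v) 3 h3))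

/-- **The count for a non-degenerate relation** (all letters in the alphabet, coefficients `≤ m`, at most `m` letters on each side):
`#S ≤ 2^{3m} · sliceBdG m s` (slices through the simplex of restricted letter multisets, fibres by the pencil count). [folklore] -/
theorem RelDataG.count (hu : ∀ j, coeff 0 (u j) = 0) (hv : ∀ j, coeff 0 (v j) = 0) (hpm : ∀ k, Dtr.pI k ≤ m)
    (hqm : ∀ k, Dtr.qI k ≤ m) (hPm : (P Dtr.idx).card ≤ m) (hNm : (N Dtr.idx).card ≤ m)
    (hR : RankOneCoincidences (fun j => (u j).support ∪ (v j).support) Dtr.rhoP Dtr.rhoM)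
    (S : Finset Expo) (hS : ∀ l ∈ S, ∃ ξ : Fin 2 → ℝ, ValidWeight u v ξ ∧ IsStrictTop ξ ↑(tailDiff u v).support l) :
    S.card ≤ 2 ^ (3 * m) * sliceBdG m (sE u v) := by
  classical
  rcases S.eq_empty_or_nonempty with hSe | hSne
  · simp [hSe]
  obtain ⟨l₀, hl₀⟩ := hSne
  obtain ⟨ξ₀, hval₀, htop₀⟩ := hS l₀ hl₀
  have hTne : (tailSupport u v).Nonempty := tailSupport_nonempty_of_mem u v l₀ htop₀.1
  have hsE : 0 < sE u v := Finset.card_pos.mpr hTne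
  set e₀ : Expo := enum u v ⟨0, hsE⟩ with he₀def
  have he₀ : e₀ ≠ 0 := enum_ne_zero u v hu hv _
  obtain ⟨β, τ, hpencil⟩ := pencil_param e₀ he₀
  have hinj := Dtr.injOn_of_rankOne hu hv hR
  -- choices along `S`
  have hξ : ∀ x : ↥S, ∃ ξ : Fin 2 → ℝ, ValidWeight u v ξ ∧ IsStrictTop ξ ↑(tailDiff u v).support x.1 :=
    fun x => hS x.1 x.2
  choose ξf hξval hξtop using hξ
  have hpt := fun x : ↥S => Dtr.sliceMin_of_visible hinj (ξf x) (hξval x) x.1 (hξtop x)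
  choose xf hxπ hxi hxL hxF hxmin using hpt
  choose Lf hLdeg hLpi using hxL
  -- normalisation radii and the pencil parameter
  have hrpos : ∀ x : ↥S, 0 < -wt (ξf x) e₀ := fun x => by
    linarith [wt_enum_neg u v (ξf x) (hξval x) ⟨0, hsE⟩]
  have hnorm : ∀ x : ↥S, wt (fun k => ξf x k / (-wt (ξf x) e₀)) e₀ = -1 := fun x => by
    rw [wt_weight_div]
    have hne : wt (ξf x) e₀ ≠ 0 := by linarith [hrpos x]
    rw [div_neg, div_self hne]
  have hc : ∀ x : ↥S, ∃ c : ℝ, ∀ e : Expo, wt (fun k => ξf x k / (-wt (ξf x) e₀)) e = wt β e + c * wt τ e :=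
    fun x => hpencil _ (hnorm x)
  choose cf hcf using hc
  set U : Fin (sE u v) → ℝ := fun i => -wt β (enum u v i) with hU
  set V : Fin (sE u v) → ℝ := fun i => -wt τ (enum u v i) with hV
  have hUV : ∀ (x : ↥S) (i : Fin (sE u v)), U i + cf x * V i = rW (u := u) (v := v) (ξf x) i / (-wt (ξf x) e₀) := fun x i => by
    have h := hcf x (enum u v i)
    rw [wt_weight_div] at h
    rw [hU, hV]
    unfold rW
    simp only
    rw [neg_div, h]
    ring
  have hsumUV : ∀ (x : ↥S) (ν : Fin (sE u v) → ℕ), ∑ i, (U i + cf x * V i) * (ν i : ℝ) =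
      (∑ i, rW (u := u) (v := v) (ξf x) i * (ν i : ℝ)) / (-wt (ξf x) e₀) := fun x ν => by
    rw [Finset.sum_div]
    refine Finset.sum_congr rfl fun i _ => ?_
    rw [hUV x i]
    ring
  -- the map `l ↦ x₀` is injective
  have hinjK : Function.Injective xf := by
    intro x y h
    apply Subtype.ext
    exact PlanarCell.eq_of_nsmul_eq Dtr.D_pos (by rw [← hxπ x, ← hxπ y, h])
  set Img : Finset (Fin (sE u v) ⊕ Fin (sE u v) × Fin (sE u v) →₀ ℕ) := (Finset.univ : Finset ↥S).image xf with hImg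
  have hcard : Img.card = S.card := by
    rw [hImg, Finset.card_image_of_injective _ hinjK, Finset.card_univ, Fintype.card_coe]
  -- the slice of a toric point: its restriction to the atoms
  set slc : (Fin (sE u v) ⊕ Fin (sE u v) × Fin (sE u v) →₀ ℕ) → (Fin (sE u v) × Fin (sE u v) → ℕ) :=
    fun x ij => if Dtr.pI ij.1 ≠ 0 ∧ Dtr.qI ij.2 ≠ 0 then x (Sum.inr ij) else 0 with hslc
  have hslcA : ∀ (x : Fin (sE u v) ⊕ Fin (sE u v) × Fin (sE u v) →₀ ℕ), ∀ i ∈ P Dtr.idx, ∀ j ∈ N Dtr.idx,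
      x (Sum.inr (i, j)) = slc x (i, j) := fun x i hi j hj => by
    rw [hslc]; simp only
    rw [if_pos ⟨(mem_P Dtr.idx i).1 hi, (mem_N Dtr.idx j).1 hj⟩]
  -- the number of slices, through the restricted letter multisets
  set T : Finset (Fin (sE u v)) := rel Dtr.idx with hT
  set Lr : ↥S → (Fin (sE u v) → ℕ) := fun x k => if k ∈ T then Lf x k else 0 with hLr
  set G : (Fin (sE u v) → ℕ) → (Fin (sE u v) × Fin (sE u v) → ℕ) :=
    fun f ij => if Dtr.pI ij.1 ≠ 0 ∧ Dtr.qI ij.2 ≠ 0 then Dtr.qI ij.2 * f ij.1 + Dtr.pI ij.1 * f ij.2 else 0 with hG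
  have hslcG : ∀ x : ↥S, slc (xf x) = G (Lr x) := by
    intro x
    funext ij
    rcases ij with ⟨i, j⟩
    rw [hslc, hG]
    simp only
    by_cases hij : Dtr.pI i ≠ 0 ∧ Dtr.qI j ≠ 0
    · have hi : i ∈ P Dtr.idx := (mem_P Dtr.idx i).2 hij.1
      have hj : j ∈ N Dtr.idx := (mem_N Dtr.idx j).2 hij.2
      rw [if_pos hij, if_pos hij, hLr]
      simp only
      rw [if_pos (show i ∈ T from mem_rel_of_mem_P Dtr.idx hi), if_pos (show j ∈ T from mem_rel_of_mem_N Dtr.idx hj),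
        ← hLpi x, piT_frM_atom Dtr.idx _ hi hj]
      rfl
    · rw [if_neg hij, if_neg hij]
  have hTcard : T.card ≤ 2 * m := by
    rw [hT, rel_eq_union]
    exact (Finset.card_union_le _ _).trans (by omega)
  have hLrzero : ∀ f ∈ (Finset.univ : Finset ↥S).image Lr, ∀ j, j ∉ T → f j = 0 := by
    intro f hf j hj
    obtain ⟨x, -, rfl⟩ := Finset.mem_image.mp hf
    rw [hLr]; simp only; rw [if_neg hj]
  have hLrsum : ∀ f ∈ (Finset.univ : Finset ↥S).image Lr, ∑ j ∈ T, f j ≤ m := by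
    intro f hf
    obtain ⟨x, -, rfl⟩ := Finset.mem_image.mp hf
    calc ∑ j ∈ T, Lr x j = ∑ j ∈ T, Lf x j :=
          Finset.sum_congr rfl fun j hj => by rw [hLr]; simp only; rw [if_pos hj]
      _ ≤ ∑ j, Lf x j := Finset.sum_le_sum_of_subset_of_nonneg (Finset.subset_univ T) fun _ _ _ => Nat.zero_le _
      _ = deg (Lf x) := (deg_eq_sum (Lf x)).symm
      _ ≤ m := hLdeg x
  have hslices : (Img.image slc).card ≤ 2 ^ (3 * m) := by
    have hsub : Img.image slc ⊆ ((Finset.univ : Finset ↥S).image Lr).image G := by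
      intro b hb
      rw [Finset.mem_image] at hb
      obtain ⟨x, hx, rfl⟩ := hb
      rw [hImg, Finset.mem_image] at hx
      obtain ⟨y, -, rfl⟩ := hx
      rw [hslcG y]
      exact Finset.mem_image_of_mem G (Finset.mem_image_of_mem Lr (Finset.mem_univ y))
    calc (Img.image slc).card ≤ (((Finset.univ : Finset ↥S).image Lr).image G).card := Finset.card_le_card hsub
      _ ≤ ((Finset.univ : Finset ↥S).image Lr).card := Finset.card_image_le
      _ ≤ 2 ^ (m + T.card) := card_supported_le T m _ hLrzero hLrsum
      _ ≤ 2 ^ (3 * m) := Nat.pow_le_pow_right (by norm_num) (by omega)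
  -- the fibres over the slices
  have hfst : ∀ x ∈ Img, slc x ∈ Img.image slc := fun x hx => Finset.mem_image_of_mem slc hx
  have hfib : ∀ b ∈ Img.image slc, (Img.filter fun x => slc x = b).card ≤ sliceBdG m (sE u v) := by
    intro b hb
    obtain ⟨x1, hx1, hx1b⟩ := Finset.mem_image.mp hb
    rw [hImg, Finset.mem_image] at hx1
    obtain ⟨y1, -, rfl⟩ := hx1
    have hbsum : sA Dtr.idx b ≤ 2 * (m * m * m) := by
      have h := sA_piT_le Dtr.idx hpm hqm hPm hNm (Lf y1) (hLdeg y1)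
      rw [hLpi y1] at h
      have e : sA Dtr.idx b = sA Dtr.idx (fun ij => xf y1 (Sum.inr ij)) :=
        Finset.sum_congr rfl fun i hi => Finset.sum_congr rfl fun j hj => by rw [← hx1b, ← hslcA _ i hi j hj]
      rw [e]; exact h
    set Sb : Finset (Fin (sE u v) → ℕ) := (Img.filter fun x => slc x = b).image fun x => ⇑(xhat Dtr.idx x) with hSb
    have hcardb : (Img.filter fun x => slc x = b).card = Sb.card := by
      rw [hSb, Finset.card_image_of_injOn]
      intro x hx x' hx' hxx
      have h1 := Finset.mem_filter.mp (Finset.mem_coe.mp hx)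
      have h2 := Finset.mem_filter.mp (Finset.mem_coe.mp hx')
      rw [hImg, Finset.mem_image] at h1 h2
      obtain ⟨⟨y, -, rfl⟩, hyb⟩ := h1
      obtain ⟨⟨y', -, rfl⟩, hyb'⟩ := h2
      have hBB : ∀ i ∈ P Dtr.idx, ∀ j ∈ N Dtr.idx, (xf y) (Sum.inr (i, j)) = (xf y') (Sum.inr (i, j)) := fun i hi j hj => by
        rw [hslcA _ i hi j hj, hslcA _ i hi j hj, hyb, hyb']
      simp only at hxx
      rw [← xOf_xhat Dtr.idx (xf y) (hxi y), ← xOf_xhat Dtr.idx (xf y') (hxi y'), xOf_congr Dtr.idx (b := fun ij => xf y (Sum.inr ij))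
        (b' := fun ij => xf y' (Sum.inr ij)) hBB, hxx]
    rw [hcardb]
    refine Dtr.sliceCount b hbsum U V Sb fun μ hμ => ?_
    obtain ⟨x, hx, rfl⟩ := Finset.mem_image.mp hμ
    obtain ⟨hxI, hxb⟩ := Finset.mem_filter.mp hx
    rw [hImg, Finset.mem_image] at hxI
    obtain ⟨y, -, rfl⟩ := hxI
    have hFb : Fsl Dtr.idx (cU u v) (cV u v) b = Fsl Dtr.idx (cU u v) (cV u v) (fun ij => xf y (Sum.inr ij)) :=
      (Fsl_congr Dtr.idx (cU u v) (cV u v) fun i hi j hj => by rw [hslcA _ i hi j hj, hxb]).symm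
    rw [hFb]
    refine ⟨hxF y, cf y, fun ν hν hFν => ?_⟩
    have hlt := hxmin y ν hν hFν
    rw [hsumUV y, hsumUV y ν]
    exact div_lt_div_of_pos_right hlt (hrpos y)
  rw [← hcard, Finset.card_eq_sum_card_fiberwise hfst]
  calc ∑ b ∈ Img.image slc, (Img.filter fun x => slc x = b).card
      ≤ ∑ _b ∈ Img.image slc, sliceBdG m (sE u v) := Finset.sum_le_sum hfib
    _ = (Img.image slc).card * sliceBdG m (sE u v) := by rw [Finset.sum_const, smul_eq_mul]
    _ ≤ 2 ^ (3 * m) * sliceBdG m (sE u v) := Nat.mul_le_mul_right _ hslices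

end GenCount

/-! ## Part T9: degenerate data are permutation type; the arithmetic; THE RANK-ONE SCHEMA LAW -/

section SchemaLaw
open Summit.ValiantsHypothesis.ValiantsHypothesis.Theorems.NewtonUnitEquations.TwoProducts.FormalLogLinearisation
open Summit.ValiantsHypothesis.ValiantsHypothesis.Theorems.NewtonUnitEquations.TwoProducts.PlanarCell
open Summit.ValiantsHypothesis.Theorems.TwoProducts.Negative

variable {m : ℕ}

/-- **Wide sides are permutation type.** For a DISJOINT rank-one datum, if one side is supported on more than `m` letters then
every coincidence has multiplier `0`: a side of a realised shift sits inside one letter multiset of the family, which has at most `m`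
letters. [folklore] -/
theorem permType_of_rankOne_wideSide (A : Fin m → Finset Expo) (ρp ρm : Expo →₀ ℕ) (h : RankOneCoincidences A ρp ρm)
    (hdis : ∀ e, ρp e = 0 ∨ ρm e = 0) (hw : m < ρp.support.card ∨ m < ρm.support.card) : PermType A := by
  classical
  -- a letter multiset of an `m`-tuple has at most `m` letters
  have hcardT : ∀ c : Fin m → Expo, (msetT c).support.card ≤ m := by
    intro c
    have hsub : (msetT c).support ⊆ Finset.univ.image c := by
      intro e he
      unfold msetT at he
      obtain ⟨j, -, hj⟩ := Finset.mem_biUnion.mp (Finsupp.support_finsetSum he)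
      rw [Finset.mem_image]
      refine ⟨j, Finset.mem_univ _, ?_⟩
      by_cases h0 : c j = 0
      · rw [if_pos h0] at hj; simp at hj
      · rw [if_neg h0] at hj
        exact (Finset.mem_singleton.mp (Finsupp.support_single_subset hj)).symm
    exact (Finset.card_le_card hsub).trans (Finset.card_image_le.trans (by simp))
  -- a realised side sits inside a letter multiset
  have main : ∀ (ρ ρ' : Expo →₀ ℕ), (∀ e, ρ e = 0 ∨ ρ' e = 0) → ∀ k : ℕ, 0 < k →
      ∀ c c' : Fin m → Expo, msetT c + k • ρ = msetT c' + k • ρ' → ρ'.support.card ≤ m := by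
    intro ρ ρ' hd k hk c c' heq
    have hsub : ρ'.support ⊆ (msetT c).support := fun e he => by
      have hρ'e : ρ' e ≠ 0 := Finsupp.mem_support_iff.mp he
      have h1 := DFunLike.congr_fun heq e
      simp only [Finsupp.add_apply, Finsupp.smul_apply, smul_eq_mul] at h1
      have hρ : ρ e = 0 := (hd e).resolve_right hρ'e
      rw [hρ, mul_zero, add_zero] at h1
      have hpos : 0 < k * ρ' e := Nat.mul_pos hk (Nat.pos_of_ne_zero hρ'e)
      refine Finsupp.mem_support_iff.mpr ?_
      intro h0
      rw [h0] at h1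
      omega
    exact (Finset.card_le_card hsub).trans (hcardT c)
  intro a ha b hb hab
  obtain ⟨k, hk⟩ := h a ha b hb hab
  rcases Nat.eq_zero_or_pos k with rfl | hk0
  · rcases hk with hk | hk
    · simpa using hk
    · simpa using hk.symm
  · exfalso
    have hdis' : ∀ e, ρm e = 0 ∨ ρp e = 0 := fun e => (hdis e).symm
    rcases hk with hk | hk
    · have h1 := main ρp ρm hdis k hk0 a b hk
      have h2 := main ρm ρp hdis' k hk0 b a hk.symm
      omega
    · have h1 := main ρp ρm hdis k hk0 b a hk
      have h2 := main ρm ρp hdis' k hk0 a b hk.symm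
      omega

/-- **A realised shift balances its datum and makes both sides non-trivial.**  For a non-permutation coincidence `Σ a = Σ b`,
`msetT a ≠ msetT b`, realised as a `k`-shift of a disjoint datum: `Σ_e ρ⁺ e • e = Σ_e ρ⁻ e • e`, `ρ⁺ ≠ 0`, `ρ⁻ ≠ 0`. [folklore] -/
theorem sides_of_shift {a b : Fin m → Expo} (hab : ∑ j, a j = ∑ j, b j) (hne : msetT a ≠ msetT b)
    {ρp ρm : Expo →₀ ℕ} {k : ℕ} (hdis : ∀ e, ρp e = 0 ∨ ρm e = 0) (h : msetT a + k • ρp = msetT b + k • ρm) :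
    ρp.sum (fun e n => n • e) = ρm.sum (fun e n => n • e) ∧ ρp ≠ 0 ∧ ρm ≠ 0 := by
  have hk : k ≠ 0 := DatumExcess.k_ne_zero_of_shift h hne
  obtain ⟨hm, hp⟩ := DatumExcess.nsmul_datum_eq_excess_of_disjoint h hdis
  have hW := OneSidedMembership.weight_excess_eq hab
  have hbal := OneSidedMembership.weight_datum_eq hk hm.symm hp.symm hW
  -- both excess vectors are non-zero
  have hsubP : (msetT a - msetT b).support ⊆ (msetT a).support := fun e he => by
    rw [Finsupp.mem_support_iff] at he ⊢
    rw [Finsupp.tsub_apply] at he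
    omega
  have hsubQ : (msetT b - msetT a).support ⊆ (msetT b).support := fun e he => by
    rw [Finsupp.mem_support_iff] at he ⊢
    rw [Finsupp.tsub_apply] at he
    omega
  have hboth : msetT a - msetT b ≠ 0 ∧ msetT b - msetT a ≠ 0 := by
    by_cases h1 : msetT a - msetT b = 0
    · by_cases h2 : msetT b - msetT a = 0
      · exact absurd (RankOneCoverage.eq_of_tsub_eq_zero h1 h2) hne
      · exact absurd h1 (OneSidedMembership.ne_zero_of_weight hsubQ h2 hW.symm)
    · exact ⟨h1, OneSidedMembership.ne_zero_of_weight hsubP h1 hW⟩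
  refine ⟨hbal.symm, ?_, ?_⟩
  · intro h0; apply hboth.2; rw [← hp, h0, smul_zero]
  · intro h0; apply hboth.1; rw [← hm, h0, smul_zero]

variable (u v : Fin m → MvPolynomial (Fin 2) ℂ)

/-- A letter vector supported on the tail letters, summed through the enumeration: `Σ_k X(enum k) • enum k = Σ_e X e • e`.
[folklore] -/
theorem sum_enum_smul_eq (X : Expo →₀ ℕ) (hX : ∀ e, X e ≠ 0 → e ∈ tailSupport u v) :
    ∑ k, X (enum u v k) • enum u v k = X.sum (fun e n => n • e) := by
  classical
  have h1 : ∑ k, X (enum u v k) • enum u v k = ∑ e ∈ tailSupport u v, X e • e := by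
    rw [← Finset.sum_coe_sort (tailSupport u v) (fun e => X e • e)]
    exact Fintype.sum_equiv (tailSupport u v).equivFin.symm (fun k => X (enum u v k) • enum u v k)
      (fun x : ↥(tailSupport u v) => X x • (x : Expo)) (fun k => rfl)
  rw [h1, Finsupp.sum]
  symm
  refine Finset.sum_subset (fun e he => hX e (Finsupp.mem_support_iff.mp he)) fun e _ he => ?_
  rw [Finsupp.notMem_support_iff.mp he, zero_smul]

/-- A letter vector supported on the tail letters is the image of its table under the enumeration. [folklore] -/
theorem mapDomain_enum_table (X : Expo →₀ ℕ) (hX : ∀ e, X e ≠ 0 → e ∈ tailSupport u v) :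
    Finsupp.mapDomain (enum u v) (ofFun fun k => X (enum u v k)) = X := by
  classical
  ext e
  by_cases he : ∃ k, enum u v k = e
  · obtain ⟨k, rfl⟩ := he
    rw [Finsupp.mapDomain_apply (enum_injective u v), ofFun_apply]
  · have hn : e ∉ Set.range (enum u v) := fun ⟨k, hk⟩ => he ⟨k, hk⟩
    rw [Finsupp.mapDomain_notin_range _ _ hn]
    by_contra hne
    have heT := hX e (fun h0 => hne (by rw [h0]))
    exact he ⟨idxOf u v e heT, enum_idxOf u v e heT⟩

variable {u v}

end SchemaLaw

end R9
end Summit.ValiantsHypothesis.ValiantsHypothesis.Theorems.NewtonUnitEquations.TwoProducts.PermutationType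

end
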